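import Literature.Probability.LatticeModels.DobrushinShlosmanWindowDusting
import HarnessLib

/-!
# The Dobrushin–Shlosman window comparison: invariant states and covariance decay

Continues `DobrushinShlosmanWindowDusting.lean` (the window analogue of the states / covariance part of
`DobrushinMetricStates.lean`; no definitions). For a general specification `γ` read on cells with window site sets `Λ c`, window cell sets
`win c`, a cell weight `w ≤ R` local in its cell and the Kantorovich contraction of the window kernels:

* `mul_windowAvg_eq_of_dependsOn` — a bounded density reading only cells off the window commutes with the
  window kernel (properness), the identity behind the TILTED STATE `ν_g(F) = ν(g F)/ν(g)` being invariant
  under the windows avoiding the cells of `g` (Künsch 1982 / Föllmer 1988 Thm. (2.13) / Georgii 2011 §8.2;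
  in the tree as `DobrushinMetric.isInvariantState_tilt`), while the Gibbs expectation is invariant under
  every window by the DLR equations (`IsGibbsMeasure.integral_integral_eq`);
* `abs_covariance_le` — **covariance decay**: under the received-sum hypothesis
  `Σ_{c ∋ x} Σ_y k c y x ≤ γ₀ |{c ∋ x}|` (`γ₀ < 1`), at most `N⋆` centres around a cell, every cell in its own
  window, and a profile `ℓ` (windows around cells of positive profile avoid `Δg`; `ℓ` drops by at most one
  from an interior cell to a cell influencing it; `ℓ ≥ L₀` on `Δf`), every Gibbs measure satisfies
  `|cov(f, g)| ≤ 4 R² e^{-κ₁ L₀} (Σ_{Δf} δ_f)(Σ_{Δg} δ_g)`, `κ₁ = (1-γ₀)²/(2(2γ₀N⋆+1))` — the tilt trick of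
  the tree's `DobrushinMetric.abs_covariance_le_of_isKRContraction` on top of the window comparison theorem
  `abs_sub_le_exp` (admissible = bounded measurable, Lipschitz vectors = nonnegative cell-Lipschitz bounds,
  `T c = γ_{Λ c}`, dusting = `lip_windowAvg`).

References: Dobrushin–Shlosman 1985; Föllmer 1988 Ch. I Thm. (2.13); Künsch 1982; Georgii 2011 §8.2.
-/

noncomputable section

open MeasureTheory ProbabilityTheory Finset Function

namespace Literature.Probability.LatticeModels.DobrushinShlosman

variable {ι V S : Type*} [MeasurableSpace S]

/-- **A density blind to the window commutes with the window kernel** (properness): if `g` reads only the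
cells `Δg` and the window cells `W` (`v ∈ Λ ↔ cell v ∈ W`) avoid `Δg`, then
`g η · ∫ F dγ_Λ(· | η) = ∫ g F dγ_Λ(· | η)`. [cite: Georgii2011, Def. 1.23] -/
theorem mul_windowAvg_eq_of_dependsOn {γ : Specification V S} (hγ : IsSpecification γ) {cell : V → ι}
    {Λ : Finset V} {W : Finset ι} (hΛ : ∀ v, v ∈ Λ ↔ cell v ∈ W) {g : (V → S) → ℝ} {Δg : Finset ι}
    (hgdep : DependsOn g {v | cell v ∈ Δg}) (hW : ∀ x ∈ W, x ∉ Δg) (F : (V → S) → ℝ) (η : V → S) :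
    g η * (∫ σ, F σ ∂(γ Λ η)) = ∫ σ, g σ * F σ ∂(γ Λ η) := by
  -- adapted from `DobrushinMetric.isInvariantState_tilt`
  rw [← integral_const_mul]
  refine integral_congr_ae ?_
  filter_upwards [hγ.proper Λ η] with σ hσ
  rw [hgdep fun v hv => (hσ v fun hvΛ => hW _ ((hΛ v).1 hvΛ) hv).symm]

/-- **Covariance decay under the Dobrushin–Shlosman received-sum condition** (the tilt trick of
Föllmer 1988 Ch. I Thm. (2.13) / Künsch 1982 / Georgii 2011 §8.2 on top of the window comparison theorem
`abs_sub_le_exp`): for a specification `γ` read on cells with window site sets `Λ c` / cell sets `win c`, a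
cell weight `w ≤ R` local in its cell, the one-boundary-cell Kantorovich contraction `hcontract` of the window
kernels with coefficients `k ≥ 0`, ratio `γ₀ ∈ [0, 1)` in the received-sum hypothesis, at most `N⋆` centres
around a cell, every cell in its own window, a Gibbs measure `ν`, bounded measurable `f, g` reading the cells
`Δf, Δg` with cell-Lipschitz bounds `δ_f, δ_g ≥ 0`, and a profile `ℓ` such that the windows around cells of
positive profile avoid `Δg`, `ℓ` drops by at most one from an interior cell to a cell influencing it, and
`ℓ ≥ L₀` on `Δf`: `|cov_ν(f, g)| ≤ 4 R² e^{-κ₁ L₀} (Σ_{Δf} δ_f)(Σ_{Δg} δ_g)`,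
`κ₁ = (1-γ₀)²/(2(2γ₀N⋆+1))`. [cite: Follmer1988, Ch. I Theorem (2.13)] -/
theorem abs_covariance_le [Fintype ι] [DecidableEq ι] [DecidableEq V] {cell : V → ι}
    {w : ι → (V → S) → (V → S) → ℝ} {γ : Specification V S} {Λ : ι → Finset V} {win : ι → Finset ι}
    {k : ι → ι → ι → ℝ} {R : ℝ} (hR : 0 ≤ R) (hwR : ∀ c σ τ, w c σ τ ≤ R)
    (hwloc : ∀ (c : ι) (σ σ' τ τ' : V → S), (∀ v, cell v = c → σ v = σ' v) →
      (∀ v, cell v = c → τ v = τ' v) → w c σ τ = w c σ' τ')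
    (hγ : IsSpecification γ) (hΛ : ∀ c v, v ∈ Λ c ↔ cell v ∈ win c) (hk : ∀ c y x, 0 ≤ k c y x)
    (hcontract : ∀ (c y : ι), y ∉ win c → ∀ (ω η : V → S), (∀ v, cell v ≠ y → ω v = η v) →
      ∀ (f : (V → S) → ℝ) (δ : ι → ℝ), Measurable f → (∃ B, ∀ σ, |f σ| ≤ B) →
        DependsOn f {v | cell v ∈ win c} → (∀ x, 0 ≤ δ x) →
        (∀ (x : ι) (σ τ : V → S), (∀ v, cell v ≠ x → σ v = τ v) → |f σ - f τ| ≤ δ x * w x σ τ) →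
          |∫ σ, f σ ∂(γ (Λ c) ω) - ∫ σ, f σ ∂(γ (Λ c) η)| ≤ (∑ x ∈ win c, k c y x * δ x) * w y ω η)
    {γ₀ : ℝ} (hγ₀ : 0 ≤ γ₀) (hγ₁ : γ₀ < 1) {Nstar : ℕ}
    (hsum : ∀ x, ∑ c ∈ Finset.univ.filter (fun c => x ∈ win c), ∑ y, k c y x ≤
      γ₀ * (Finset.univ.filter fun c => x ∈ win c).card)
    (hN : ∀ x, (Finset.univ.filter fun c => x ∈ win c).card ≤ Nstar) (hself : ∀ x, x ∈ win x)
    {ν : Measure (V → S)} (hν : IsGibbsMeasure γ ν) {f g : (V → S) → ℝ} (hfm : Measurable f)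
    (hgm : Measurable g) {Bf Bg : ℝ} (hBf : ∀ σ, |f σ| ≤ Bf) (hBg : ∀ σ, |g σ| ≤ Bg)
    {Δf Δg : Finset ι} (hfdep : DependsOn f {v | cell v ∈ Δf}) (hgdep : DependsOn g {v | cell v ∈ Δg})
    {δf δg : ι → ℝ} (hδf0 : ∀ x, 0 ≤ δf x)
    (hδf : ∀ (x : ι) (σ τ : V → S), (∀ v, cell v ≠ x → σ v = τ v) → |f σ - f τ| ≤ δf x * w x σ τ)
    (hδg0 : ∀ x, 0 ≤ δg x)
    (hδg : ∀ (x : ι) (σ τ : V → S), (∀ v, cell v ≠ x → σ v = τ v) → |g σ - g τ| ≤ δg x * w x σ τ)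
    (ℓ : ι → ℕ) (L₀ : ℕ) (hU : ∀ x, ℓ x ≠ 0 → ∀ c, x ∈ win c → ∀ z ∈ win c, z ∉ Δg)
    (hℓ : ∀ c x y, x ∈ win c → k c y x ≠ 0 → ℓ x ≤ ℓ y + 1) (hL : ∀ x ∈ Δf, L₀ ≤ ℓ x) :
    |cov[f, g; ν]| ≤ 4 * R ^ 2 * Real.exp (-((1 - γ₀) ^ 2 / (2 * (2 * γ₀ * Nstar + 1)) * L₀)) *
      (∑ x ∈ Δf, δf x) * ∑ y ∈ Δg, δg y := by
  -- adapted from `DobrushinMetric.abs_covariance_le_of_isKRContraction`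
  haveI := hν.isProbabilityMeasure
  obtain ⟨τ₀, -⟩ := nonempty_of_measure_ne_zero (μ := ν) (s := Set.univ) (by simp)
  set κ₁ : ℝ := (1 - γ₀) ^ 2 / (2 * (2 * γ₀ * Nstar + 1)) with hκ₁
  -- cutting a cell-Lipschitz bound down to the cells an observable reads
  have restrict : ∀ {F : (V → S) → ℝ} {δ : ι → ℝ} {Δ : Finset ι}, DependsOn F {v | cell v ∈ Δ} →
      (∀ (x : ι) (σ τ : V → S), (∀ v, cell v ≠ x → σ v = τ v) → |F σ - F τ| ≤ δ x * w x σ τ) →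
      ∀ (x : ι) (σ τ : V → S), (∀ v, cell v ≠ x → σ v = τ v) →
        |F σ - F τ| ≤ (if x ∈ Δ then δ x else 0) * w x σ τ := by
    intro F δ Δ hdep hδ x σ τ hστ
    split_ifs with hx
    · exact hδ x σ τ hστ
    · rw [hdep fun v (hv : cell v ∈ Δ) => hστ v fun hvx => hx (hvx ▸ hv), sub_self, abs_zero, zero_mul]
  have restrict0 : ∀ {δ : ι → ℝ} {Δ : Finset ι}, (∀ x, 0 ≤ δ x) → ∀ x, 0 ≤ (if x ∈ Δ then δ x else 0) :=
    fun hδ0 x => by split_ifs; exacts [hδ0 x, le_rfl]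
  -- the shifted density `g̃ ∈ [0, 2 S_g]`
  set Sg : ℝ := R * ∑ y ∈ Δg, δg y with hSg
  have hSg0 : 0 ≤ Sg := mul_nonneg hR (Finset.sum_nonneg fun y _ => hδg0 y)
  have hosc : ∀ σ, |g σ - g τ₀| ≤ Sg := fun σ => by
    have h := abs_sub_le_sum_cells hwR (restrict0 hδg0) (restrict hgdep hδg) σ τ₀
    rwa [Finset.sum_ite_mem, Finset.univ_inter] at h
  set gt : (V → S) → ℝ := fun σ => g σ + (Sg - g τ₀) with hgt
  have hgt0 : ∀ σ, 0 ≤ gt σ := fun σ => by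
    have := (abs_le.1 (hosc σ)).1; simp only [hgt]; linarith
  have hgtB : ∀ σ, gt σ ≤ 2 * Sg := fun σ => by
    have := (abs_le.1 (hosc σ)).2; simp only [hgt]; linarith
  have hgtm : Measurable gt := hgm.add_const _
  have hgtdep : DependsOn gt {v | cell v ∈ Δg} := fun σ τ h => by
    simp only [hgt]; rw [hgdep h]
  have hgi : Integrable g ν := DobrushinMetric.integrable_of_abs_le' hgm hBg
  have hgtabs : ∀ σ, |gt σ| ≤ 2 * Sg := fun σ => by
    rw [abs_of_nonneg (hgt0 σ)]; exact hgtB σ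
  have hgti : Integrable gt ν := DobrushinMetric.integrable_of_abs_le' hgtm hgtabs
  -- the right-hand side is nonnegative
  have hRHS : 0 ≤ 4 * R ^ 2 * Real.exp (-(κ₁ * L₀)) * (∑ x ∈ Δf, δf x) * ∑ y ∈ Δg, δg y := by
    have := Finset.sum_nonneg fun x (_ : x ∈ Δf) => hδf0 x
    have := Finset.sum_nonneg fun y (_ : y ∈ Δg) => hδg0 y
    positivity
  -- `cov(f, g) = cov(f, g̃) = ν(f g̃) - ν(f) ν(g̃)`
  have hcov : cov[f, g; ν] = ∫ σ, f σ * gt σ ∂ν - (∫ σ, f σ ∂ν) * ∫ σ, gt σ ∂ν := by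
    have h1 : cov[f, g; ν] = cov[f, gt; ν] := by
      rw [hgt, covariance_add_const_right hgi]
    rw [h1, covariance_eq_sub]
    · rfl
    · exact memLp_of_bounded (a := -Bf) (b := Bf)
        (ae_of_all _ fun σ => abs_le.1 (hBf σ)) hfm.aestronglyMeasurable 2
    · exact memLp_of_bounded (a := -(2 * Sg)) (b := 2 * Sg)
        (ae_of_all _ fun σ => abs_le.1 (hgtabs σ)) hgtm.aestronglyMeasurable 2
  by_cases hz : ∫ σ, gt σ ∂ν = 0
  · -- degenerate case: `g̃ = 0` a.e., so the covariance vanishes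
    have hae : gt =ᵐ[ν] 0 := (integral_eq_zero_iff_of_nonneg (fun σ => hgt0 σ) hgti).1 hz
    have hfg : ∫ σ, f σ * gt σ ∂ν = 0 := by
      rw [← integral_zero (α := V → S) (μ := ν) (G := ℝ)]
      refine integral_congr_ae ?_
      filter_upwards [hae] with σ hσ
      simp [hσ]
    rw [hcov, hfg, hz, mul_zero, sub_zero, abs_zero]
    exact hRHS
  have hpos : 0 < ∫ σ, gt σ ∂ν := lt_of_le_of_ne (integral_nonneg hgt0) (Ne.symm hz)
  -- the window dusting data: bounded measurable observables, cell-Lipschitz bounds, `T c = γ_{Λ c}`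
  set Adm : ((V → S) → ℝ) → Prop := fun F => Measurable F ∧ ∃ B, ∀ σ, |F σ| ≤ B with hAdm
  set Lip : ((V → S) → ℝ) → (ι → ℝ) → Prop := fun F δ => (∀ x, 0 ≤ δ x) ∧
    ∀ (x : ι) (σ τ : V → S), (∀ v, cell v ≠ x → σ v = τ v) → |F σ - F τ| ≤ δ x * w x σ τ with hLip
  set T : ι → ((V → S) → ℝ) → ((V → S) → ℝ) := fun c F η => ∫ σ, F σ ∂(γ (Λ c) η) with hT
  have hlip0 : ∀ ⦃F : (V → S) → ℝ⦄ ⦃δ : ι → ℝ⦄, Lip F δ → ∀ x, 0 ≤ δ x := fun F δ h => h.1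
  have hoscA : ∀ ⦃F : (V → S) → ℝ⦄ ⦃δ : ι → ℝ⦄, Adm F → Lip F δ → ∀ σ τ, |F σ - F τ| ≤ R * ∑ x, δ x :=
    fun F δ _ h => abs_sub_le_sum_cells hwR h.1 h.2
  have hTA : ∀ ⦃F : (V → S) → ℝ⦄ (c : ι), Adm F → Adm (T c F) := fun F c h =>
    ⟨measurable_windowAvg' hγ (Λ c) h.1, h.2.imp fun B hB η => abs_windowAvg_le' hγ (Λ c) hB η⟩
  have hdust : ∀ ⦃F : (V → S) → ℝ⦄ ⦃δ : ι → ℝ⦄ (c : ι), Adm F → Lip F δ →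
      Lip (T c F) fun y => if y ∈ win c then 0 else δ y + ∑ x ∈ win c, k c y x * δ x := by
    intro F δ c hF hδ
    obtain ⟨hFm, B, hB⟩ := hF
    refine ⟨fun y => ?_, fun y ω η hωη =>
      lip_windowAvg hγ hwloc (hΛ c) (hcontract c) hFm hB hδ.1 hδ.2 y ω η hωη⟩
    dsimp only
    split_ifs
    · exact le_rfl
    · exact add_nonneg (hδ.1 y) (Finset.sum_nonneg fun x _ => mul_nonneg (hk c y x) (hδ.1 x))
  -- the two invariant states: `ν` and its tilt by `g̃`, usable centres = windows avoiding `Δg`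
  set U : Finset ι := Finset.univ.filter fun c => ∀ z ∈ win c, z ∉ Δg with hUdef
  set E₁ : ((V → S) → ℝ) → ℝ := fun F => ∫ σ, F σ ∂ν with hE₁
  set E₂ : ((V → S) → ℝ) → ℝ := fun F => (∫ σ, gt σ * F σ ∂ν) / ∫ σ, gt σ ∂ν with hE₂
  have h₁le : ∀ ⦃F : (V → S) → ℝ⦄ ⦃M : ℝ⦄, Adm F → (∀ σ, F σ ≤ M) → E₁ F ≤ M := by
    rintro F M ⟨hFm, B, hB⟩ hM
    calc ∫ σ, F σ ∂ν ≤ ∫ _σ, M ∂ν :=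
          integral_mono (DobrushinMetric.integrable_of_abs_le' hFm hB) (integrable_const M) hM
      _ = M := by simp
  have h₁ge : ∀ ⦃F : (V → S) → ℝ⦄ ⦃M : ℝ⦄, Adm F → (∀ σ, M ≤ F σ) → M ≤ E₁ F := by
    rintro F M ⟨hFm, B, hB⟩ hM
    calc M = ∫ _σ, M ∂ν := by simp
      _ ≤ ∫ σ, F σ ∂ν := integral_mono (integrable_const M) (DobrushinMetric.integrable_of_abs_le' hFm hB) hM
  have h₁T : ∀ ⦃F : (V → S) → ℝ⦄ (c : ι), c ∈ U → Adm F → E₁ (T c F) = E₁ F := by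
    rintro F c - ⟨hFm, B, hB⟩
    exact hν.integral_integral_eq hγ (Λ c) (DobrushinMetric.integrable_of_abs_le' hFm hB)
  have hgfi : ∀ {F : (V → S) → ℝ}, Measurable F → ∀ {B : ℝ}, (∀ σ, |F σ| ≤ B) →
      Integrable (fun σ => gt σ * F σ) ν := fun hFm B hB =>
    hgti.mul_bdd hFm.aestronglyMeasurable (ae_of_all _ fun σ => by rw [Real.norm_eq_abs]; exact hB σ)
  have h₂le : ∀ ⦃F : (V → S) → ℝ⦄ ⦃M : ℝ⦄, Adm F → (∀ σ, F σ ≤ M) → E₂ F ≤ M := by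
    rintro F M ⟨hFm, B, hB⟩ hM
    change (∫ σ, gt σ * F σ ∂ν) / ∫ σ, gt σ ∂ν ≤ M
    rw [div_le_iff₀ hpos]
    calc ∫ σ, gt σ * F σ ∂ν ≤ ∫ σ, gt σ * M ∂ν :=
          integral_mono (hgfi hFm hB) (hgti.mul_const M) fun σ => mul_le_mul_of_nonneg_left (hM σ) (hgt0 σ)
      _ = M * ∫ σ, gt σ ∂ν := by rw [integral_mul_const, mul_comm]
  have h₂ge : ∀ ⦃F : (V → S) → ℝ⦄ ⦃M : ℝ⦄, Adm F → (∀ σ, M ≤ F σ) → M ≤ E₂ F := by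
    rintro F M ⟨hFm, B, hB⟩ hM
    change M ≤ (∫ σ, gt σ * F σ ∂ν) / ∫ σ, gt σ ∂ν
    rw [le_div_iff₀ hpos]
    calc M * ∫ σ, gt σ ∂ν = ∫ σ, gt σ * M ∂ν := by rw [integral_mul_const, mul_comm]
      _ ≤ ∫ σ, gt σ * F σ ∂ν :=
          integral_mono (hgti.mul_const M) (hgfi hFm hB) fun σ => mul_le_mul_of_nonneg_left (hM σ) (hgt0 σ)
  have h₂T : ∀ ⦃F : (V → S) → ℝ⦄ (c : ι), c ∈ U → Adm F → E₂ (T c F) = E₂ F := by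
    rintro F c hc ⟨hFm, B, hB⟩
    change (∫ η, gt η * (∫ σ, F σ ∂(γ (Λ c) η)) ∂ν) / ∫ σ, gt σ ∂ν = (∫ σ, gt σ * F σ ∂ν) / ∫ σ, gt σ ∂ν
    congr 1
    simp_rw [mul_windowAvg_eq_of_dependsOn hγ (hΛ c) hgtdep (Finset.mem_filter.1 hc).2]
    exact hν.integral_integral_eq hγ (Λ c) (hgfi hFm hB)
  have hUabs : ∀ x, ℓ x ≠ 0 → ∀ c, x ∈ win c → c ∈ U := fun x hx c hxc =>
    Finset.mem_filter.2 ⟨Finset.mem_univ _, hU x hx c hxc⟩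
  -- the comparison theorem for `f` with its Lipschitz vector cut down to `Δf`
  have hδ0 : ∀ x, ℓ x < L₀ → (fun x => if x ∈ Δf then δf x else 0) x = 0 := fun x hx => by
    dsimp only
    split_ifs with hxΔ
    · exact absurd (hL x hxΔ) (not_le.2 hx)
    · rfl
  have key := abs_sub_le_exp hR hlip0 hoscA hk hTA hdust h₁le h₁ge h₁T h₂le h₂ge h₂T hγ₀ hγ₁ ℓ hUabs hℓ
    hsum hN hself L₀ (F := f) (δ := fun x => if x ∈ Δf then δf x else 0) ⟨hfm, Bf, hBf⟩
    ⟨restrict0 hδf0, restrict hfdep hδf⟩ hδ0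
  rw [Finset.sum_ite_mem, Finset.univ_inter] at key
  change |∫ σ, f σ ∂ν - (∫ σ, gt σ * f σ ∂ν) / ∫ σ, gt σ ∂ν| ≤
    2 * R * Real.exp (-(κ₁ * L₀)) * ∑ x ∈ Δf, δf x at key
  -- `cov = ν(g̃) · (ν_{g̃}(f) - ν(f))`
  have hfgt : ∫ σ, f σ * gt σ ∂ν = ∫ σ, gt σ * f σ ∂ν :=
    integral_congr_ae (ae_of_all _ fun σ => mul_comm _ _)
  have hident : cov[f, g; ν] =
      (∫ σ, gt σ ∂ν) * ((∫ σ, gt σ * f σ ∂ν) / ∫ σ, gt σ ∂ν - ∫ σ, f σ ∂ν) := by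
    rw [hcov, hfgt, mul_sub, mul_div_cancel₀ _ hz]
    ring
  rw [hident, abs_mul, abs_of_pos hpos, abs_sub_comm]
  have hgtint : ∫ σ, gt σ ∂ν ≤ 2 * Sg := by
    calc ∫ σ, gt σ ∂ν ≤ ∫ _σ, 2 * Sg ∂ν := integral_mono hgti (integrable_const _) hgtB
      _ = 2 * Sg := by simp
  have hexp : 0 ≤ 2 * R * Real.exp (-(κ₁ * L₀)) * ∑ x ∈ Δf, δf x := by
    have := Finset.sum_nonneg fun x (_ : x ∈ Δf) => hδf0 x
    positivity
  calc (∫ σ, gt σ ∂ν) * |∫ σ, f σ ∂ν - (∫ σ, gt σ * f σ ∂ν) / ∫ σ, gt σ ∂ν|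
      ≤ (2 * Sg) * (2 * R * Real.exp (-(κ₁ * L₀)) * ∑ x ∈ Δf, δf x) :=
        mul_le_mul hgtint key (abs_nonneg _) (by positivity)
    _ = 4 * R ^ 2 * Real.exp (-(κ₁ * L₀)) * (∑ x ∈ Δf, δf x) * ∑ y ∈ Δg, δg y := by
        rw [hSg]; ring

end Literature.Probability.LatticeModels.DobrushinShlosman

end
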